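import Literature.NumberTheory.Transcendental.KZCubeRationalMoves

/-!
# Torus-equivariant exactness on the Padé box (crux stmt-KontsevichZagierPeriods-3407, line `Sketch`)

Stub `stub_torusExactness` of the line `Sketch` (Padé box island, `w = 2`) of the crux
`Summit.KontsevichZagierPeriods.KontsevichZagierPeriods.Theses.HermiteRigidity.ReductionRigidity`
(stmt-KontsevichZagierPeriods-3407).

For `g = x^a y^b/(N − xy)^m` on the closed unit square one has EXACTLY
`∂ₓ(x·g) = (1 + a)·g + m·g·xy/(N − xy)` and `∂_y(y·g) = (1 + b)·g + m·g·xy/(N − xy)`, hence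
`(a − b)·g = ∂ₓ(x·g) − ∂_y(y·g)`: every unbalanced monomial (`a ≠ b`) is exact for the torus action,
at any pole order `m`.  With `G = q/(a − b) · g`, two Stokes moves of the Kontsevich–Zagier calculus
on the closed square (Ayoub's relation `KZ.RFun.stokesAt` along `x` for the primitive `x·G` and along
`y` for the primitive `y·G`) give the registered congruence
`[q x^a y^b/(N−xy)^m] ≡ [q/(a−b) · y^b/(N−y)^m]₁ − [q/(a−b) · x^a/(N−x)^m]₁` in `KZ.relations`:
the faces `x = 0`, `y = 0` carry the factor `x`, resp. `y`, and vanish, the faces `x = 1`, `y = 1`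
are the two line generators.  Everything is phrased with the regular rational functions `KZ.RFun`
on the closed cube (`KZCubeRational.lean`, `KZCubeRationalMoves.lean`), whose moves carry no side
conditions; the derivative `RFun.pd` is identified symbolically (`MvPolynomial.pderiv`).

## References

* M. Kontsevich, D. Zagier, *Periods* (2001), §1.2. [cite: KontsevichZagier2001, §1.2]
* J. Ayoub, *Periods and the conjectures of Grothendieck and Kontsevich–Zagier*, EMS Newsletter 91
  (2014), §2.2, Def. 10. [cite: Ayoub2014, Def. 10]
-/

noncomputable section

open MeasureTheory Set MvPolynomial

namespace Summit.KontsevichZagierPeriods.HermiteRigidity.ReductionRigidity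

open Literature.NumberTheory.Transcendental
open Literature.NumberTheory.Transcendental.KZ

/-! ## The box denominator -/

/-- On the closed unit square, `N − xy ≥ 1` for `N ≥ 2`. [folklore] -/
private theorem torusExactness_one_le_sub {N : ℕ} (hN : 2 ≤ N) {p : Fin 2 → ℝ} (hp : p ∈ cube 2) :
    (1 : ℝ) ≤ (N : ℝ) - p 0 * p 1 := by
  have h2 : (2 : ℝ) ≤ (N : ℝ) := by exact_mod_cast hN
  have h0 := hp 0
  have h1 := hp 1
  nlinarith [mul_le_one₀ h0.2 h1.1 h1.2, mul_nonneg h0.1 h1.1]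

/-- The box denominator `(N − xy)^m` does not vanish on the closed square (`N ≥ 2`). [folklore] -/
private theorem torusExactness_boxDen_ne {N : ℕ} (hN : 2 ≤ N) (m : ℕ) :
    ∀ p ∈ cube 2, aeval p ((C (N : ℚ) - X 0 * X 1) ^ m : MvPolynomial (Fin 2) ℚ) ≠ 0 := by
  intro p hp
  have h := torusExactness_one_le_sub hN hp
  simp only [map_pow, map_sub, map_mul, aeval_C, aeval_X, eq_ratCast, Rat.cast_natCast]
  exact pow_ne_zero _ (by linarith)

/-! ## Coordinates of the face points of the square -/

/-- The face point `x = c` of the square has first coordinate `c`. [folklore] -/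
private theorem torusExactness_insertNth_zero_apply_zero (c : ℝ) (y : Fin 1 → ℝ) :
    (Fin.insertNth 0 c y : Fin 2 → ℝ) 0 = c :=
  Fin.insertNth_apply_same _ _ _

/-- The face point `x = c` of the square has second coordinate `y`. [folklore] -/
private theorem torusExactness_insertNth_zero_apply_one (c : ℝ) (y : Fin 1 → ℝ) :
    (Fin.insertNth 0 c y : Fin 2 → ℝ) 1 = y 0 := by
  have h : (1 : Fin 2) = (0 : Fin 2).succAbove 0 := by decide
  rw [h, Fin.insertNth_apply_succAbove]

/-- The face point `y = c` of the square has first coordinate `x`. [folklore] -/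
private theorem torusExactness_insertNth_one_apply_zero (c : ℝ) (y : Fin 1 → ℝ) :
    (Fin.insertNth 1 c y : Fin 2 → ℝ) 0 = y 0 := by
  have h : (0 : Fin 2) = (1 : Fin 2).succAbove 0 := by decide
  rw [h, Fin.insertNth_apply_succAbove]

/-- The face point `y = c` of the square has second coordinate `c`. [folklore] -/
private theorem torusExactness_insertNth_one_apply_one (c : ℝ) (y : Fin 1 → ℝ) :
    (Fin.insertNth 1 c y : Fin 2 → ℝ) 1 = c :=
  Fin.insertNth_apply_same _ _ _

/-! ## The two primitives `x·G`, `y·G` (`G = c·x^a y^b/(N−xy)^m`): derivatives and faces -/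

/-- `∂ₓ(x·G) = ((a+1)·c·x^a y^b·(N−xy)^m + m·c·x^{a+1} y^{b+1}·(N−xy)^{m-1}) / (N−xy)^{2m}` on the
closed square — the quotient rule of `KZ.RFun.pd`, read through `MvPolynomial.pderiv`. [folklore] -/
private theorem torusExactness_pd_zero_fn {N : ℕ} (hN : 2 ≤ N) (c : ℚ) (a b m : ℕ)
    (p : Fin 2 → ℝ) :
    (RFun.pd 0 (⟨C c * X 0 ^ (a + 1) * X 1 ^ b, (C (N : ℚ) - X 0 * X 1) ^ m,
        torusExactness_boxDen_ne hN m⟩ : RFun 2)).fn p =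
      ((c : ℝ) * ((a : ℝ) + 1) * (p 0 ^ a * p 1 ^ b) * ((N : ℝ) - p 0 * p 1) ^ m +
          (c : ℝ) * (m : ℝ) * (p 0 ^ (a + 1) * p 1 ^ (b + 1)) * ((N : ℝ) - p 0 * p 1) ^ (m - 1)) /
        (((N : ℝ) - p 0 * p 1) ^ m) ^ 2 := by
  have h10 : (1 : Fin 2) ≠ 0 := by decide
  simp only [RFun.fn, RFun.pd, pderiv_mul, pderiv_pow, pderiv_C, pderiv_X_self, pderiv_X_of_ne h10,
    map_sub, zero_mul, mul_zero, zero_add, add_zero, zero_sub, mul_one, one_mul,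
    add_tsub_cancel_right]
  simp only [map_sub, map_mul, map_pow, map_neg, map_natCast, aeval_C, aeval_X, eq_ratCast]
  push_cast
  ring

/-- `∂_y(y·G) = ((b+1)·c·x^a y^b·(N−xy)^m + m·c·x^{a+1} y^{b+1}·(N−xy)^{m-1}) / (N−xy)^{2m}` on the
closed square. [folklore] -/
private theorem torusExactness_pd_one_fn {N : ℕ} (hN : 2 ≤ N) (c : ℚ) (a b m : ℕ)
    (p : Fin 2 → ℝ) :
    (RFun.pd 1 (⟨C c * X 0 ^ a * X 1 ^ (b + 1), (C (N : ℚ) - X 0 * X 1) ^ m,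
        torusExactness_boxDen_ne hN m⟩ : RFun 2)).fn p =
      ((c : ℝ) * ((b : ℝ) + 1) * (p 0 ^ a * p 1 ^ b) * ((N : ℝ) - p 0 * p 1) ^ m +
          (c : ℝ) * (m : ℝ) * (p 0 ^ (a + 1) * p 1 ^ (b + 1)) * ((N : ℝ) - p 0 * p 1) ^ (m - 1)) /
        (((N : ℝ) - p 0 * p 1) ^ m) ^ 2 := by
  have h01 : (0 : Fin 2) ≠ 1 := by decide
  simp only [RFun.fn, RFun.pd, pderiv_mul, pderiv_pow, pderiv_C, pderiv_X_self, pderiv_X_of_ne h01,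
    map_sub, zero_mul, mul_zero, zero_add, add_zero, zero_sub, mul_one, add_tsub_cancel_right]
  simp only [map_sub, map_mul, map_pow, map_neg, map_natCast, aeval_C, aeval_X, eq_ratCast]
  push_cast
  ring

/-- **The bulk identity** `q·x^a y^b/(N−xy)^m = ∂ₓ(x·G) − ∂_y(y·G)`, `G = q/(a−b)·x^a y^b/(N−xy)^m`
(`a ≠ b`), as a congruence of rule (1): `[r] ≡ [∂ₓ(x·G) − ∂_y(y·G)]` for every representation `r`
of the box generator on the closed square. [cite: KontsevichZagier2001, §1.2 rule (1)] -/
private theorem torusExactness_bulk {N : ℕ} (hN : 2 ≤ N) (q : ℚ) {a b : ℕ} (m : ℕ) (hab : a ≠ b)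
    (r : IntegralRep 2) (hr : r.domain = cube 2)
    (hri : EqOn r.integrand (fun p => (q : ℝ) * (p 0 ^ a * p 1 ^ b) / ((N : ℝ) - p 0 * p 1) ^ m)
      (cube 2)) :
    KZ.of r - KZ.of ((RFun.pd 0 (⟨C (q / ((a : ℚ) - b)) * X 0 ^ (a + 1) * X 1 ^ b,
        (C (N : ℚ) - X 0 * X 1) ^ m, torusExactness_boxDen_ne hN m⟩ : RFun 2)).sub
      (RFun.pd 1 (⟨C (q / ((a : ℚ) - b)) * X 0 ^ a * X 1 ^ (b + 1),
        (C (N : ℚ) - X 0 * X 1) ^ m, torusExactness_boxDen_ne hN m⟩ : RFun 2))).rep ∈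
      KZ.relations := by
  refine KZ.of_sub_of_mem_relations_of_eqOn (by rw [RFun.rep_domain, hr]) fun p hp => ?_
  rw [hr] at hp
  have hu : (N : ℝ) - p 0 * p 1 ≠ 0 := by linarith [torusExactness_one_le_sub hN hp]
  have hab' : (a : ℝ) - b ≠ 0 := sub_ne_zero.2 (by exact_mod_cast hab)
  rw [hri hp, RFun.rep_integrand, RFun.fn_sub hp, torusExactness_pd_zero_fn hN _ a b m p,
    torusExactness_pd_one_fn hN _ a b m p]
  push_cast
  field_simp
  ring

/-- The face `x = 1` of `x·G` is the line generator `c·y^b/(N−y)^m`: `[x·G|_{x=1}] ≡ [r₁]` for every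
representation `r₁` of it on the closed interval. [cite: KontsevichZagier2001, §1.2 rule (1)] -/
private theorem torusExactness_face_x_one {N : ℕ} (hN : 2 ≤ N) (c : ℚ) (a b m : ℕ)
    (r₁ : IntegralRep 1) (hr₁ : r₁.domain = cube 1)
    (hr₁i : EqOn r₁.integrand (fun p => (c : ℝ) * p 0 ^ b / ((N : ℝ) - p 0) ^ m) (cube 1)) :
    KZ.of (RFun.faceAt 0 (⟨C c * X 0 ^ (a + 1) * X 1 ^ b, (C (N : ℚ) - X 0 * X 1) ^ m,
        torusExactness_boxDen_ne hN m⟩ : RFun 2) 1 ⟨zero_le_one, le_rfl⟩).rep - KZ.of r₁ ∈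
      KZ.relations := by
  refine KZ.of_sub_of_mem_relations_of_eqOn (by rw [RFun.rep_domain, hr₁]) fun y hy => ?_
  have hy' : y ∈ cube 1 := hy
  rw [hr₁i hy', RFun.rep_integrand, RFun.fn_faceAt]
  simp only [RFun.fn, map_mul, map_pow, map_sub, aeval_C, aeval_X, eq_ratCast, Rat.cast_natCast,
    Rat.cast_one, torusExactness_insertNth_zero_apply_zero, torusExactness_insertNth_zero_apply_one,
    one_pow, mul_one, one_mul]

/-- The face `x = 0` of `x·G` vanishes: `[x·G|_{x=0}] ≡ 0`. [cite: KontsevichZagier2001, §1.2 rule (1)] -/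
private theorem torusExactness_face_x_zero {N : ℕ} (hN : 2 ≤ N) (c : ℚ) (a b m : ℕ) :
    KZ.of (RFun.faceAt 0 (⟨C c * X 0 ^ (a + 1) * X 1 ^ b, (C (N : ℚ) - X 0 * X 1) ^ m,
        torusExactness_boxDen_ne hN m⟩ : RFun 2) 0 ⟨le_rfl, zero_le_one⟩).rep ∈ KZ.relations := by
  refine RFun.rel_of_eqOn_zero fun y _ => ?_
  rw [RFun.fn_faceAt]
  simp only [RFun.fn, map_mul, map_pow, aeval_C, aeval_X, Rat.cast_zero,
    torusExactness_insertNth_zero_apply_zero, zero_pow (Nat.add_one_ne_zero a), mul_zero, zero_mul,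
    zero_div]

/-- The face `y = 1` of `y·G` is the line generator `c·x^a/(N−x)^m`: `[y·G|_{y=1}] ≡ [r₂]` for every
representation `r₂` of it on the closed interval. [cite: KontsevichZagier2001, §1.2 rule (1)] -/
private theorem torusExactness_face_y_one {N : ℕ} (hN : 2 ≤ N) (c : ℚ) (a b m : ℕ)
    (r₂ : IntegralRep 1) (hr₂ : r₂.domain = cube 1)
    (hr₂i : EqOn r₂.integrand (fun p => (c : ℝ) * p 0 ^ a / ((N : ℝ) - p 0) ^ m) (cube 1)) :
    KZ.of (RFun.faceAt 1 (⟨C c * X 0 ^ a * X 1 ^ (b + 1), (C (N : ℚ) - X 0 * X 1) ^ m,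
        torusExactness_boxDen_ne hN m⟩ : RFun 2) 1 ⟨zero_le_one, le_rfl⟩).rep - KZ.of r₂ ∈
      KZ.relations := by
  refine KZ.of_sub_of_mem_relations_of_eqOn (by rw [RFun.rep_domain, hr₂]) fun y hy => ?_
  have hy' : y ∈ cube 1 := hy
  rw [hr₂i hy', RFun.rep_integrand, RFun.fn_faceAt]
  simp only [RFun.fn, map_mul, map_pow, map_sub, aeval_C, aeval_X, eq_ratCast, Rat.cast_natCast,
    Rat.cast_one, torusExactness_insertNth_one_apply_zero, torusExactness_insertNth_one_apply_one,
    one_pow, mul_one]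

/-- The face `y = 0` of `y·G` vanishes: `[y·G|_{y=0}] ≡ 0`. [cite: KontsevichZagier2001, §1.2 rule (1)] -/
private theorem torusExactness_face_y_zero {N : ℕ} (hN : 2 ≤ N) (c : ℚ) (a b m : ℕ) :
    KZ.of (RFun.faceAt 1 (⟨C c * X 0 ^ a * X 1 ^ (b + 1), (C (N : ℚ) - X 0 * X 1) ^ m,
        torusExactness_boxDen_ne hN m⟩ : RFun 2) 0 ⟨le_rfl, zero_le_one⟩).rep ∈ KZ.relations := by
  refine RFun.rel_of_eqOn_zero fun y _ => ?_
  rw [RFun.fn_faceAt]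
  simp only [RFun.fn, map_mul, map_pow, aeval_C, aeval_X, Rat.cast_zero,
    torusExactness_insertNth_one_apply_one, zero_pow (Nat.add_one_ne_zero b), mul_zero, zero_div]

/-! ## Assembly -/

/-- Bookkeeping in the free abelian group of representations: the bulk congruence, the two Stokes
relations and the four face identifications combine to `[r] − ([r₁] − [r₂]) ∈ relations`. [folklore] -/
private theorem torusExactness_assemble {G : Type*} [AddCommGroup G] (S : AddSubgroup G)
    {r r₁ r₂ D P₀ P₁ F₀₁ F₀₀ F₁₁ F₁₀ : G} (e0a : r - D ∈ S) (e0b : D - (P₀ - P₁) ∈ S)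
    (hs₀ : P₀ - (F₀₁ - F₀₀) ∈ S) (hs₁ : P₁ - (F₁₁ - F₁₀) ∈ S) (e01 : F₀₁ - r₁ ∈ S) (e00 : F₀₀ ∈ S)
    (e11 : F₁₁ - r₂ ∈ S) (e10 : F₁₀ ∈ S) : r - (r₁ - r₂) ∈ S := by
  have key : r - (r₁ - r₂) = (r - D) + (D - (P₀ - P₁)) + (P₀ - (F₀₁ - F₀₀)) - (P₁ - (F₁₁ - F₁₀)) +
      (F₀₁ - r₁) - F₀₀ - (F₁₁ - r₂) + F₁₀ := by abel
  rw [key]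
  exact S.add_mem (S.sub_mem (S.sub_mem (S.add_mem (S.sub_mem (S.add_mem (S.add_mem e0a e0b) hs₀)
    hs₁) e01) e00) e11) e10

/-- **Torus-equivariant exactness** (stub `stub_torusExactness` of the line `Sketch`, Padé box
island, of crux stmt-KontsevichZagierPeriods-3407): for `a ≠ b` and every pole order `m`,
`q·x^a y^b/(N−xy)^m = ∂ₓ(x·G) − ∂_y(y·G)` with `G = q/(a−b) · x^a y^b/(N−xy)^m`, so two Stokes moves
on the closed square (Ayoub's relation `[∂ᵢT] ≡ [T|_{xᵢ=1}] − [T|_{xᵢ=0}]`, an instance of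
Kontsevich–Zagier's rule (3), the faces `x = 0`, `y = 0` vanishing) give
`[q x^a y^b/(N−xy)^m] ≡ [q/(a−b) · y^b/(N−y)^m]₁ − [q/(a−b) · x^a/(N−x)^m]₁` in `KZ.relations`, for
arbitrary representations of the three integrands on the closed cubes.
[cite: KontsevichZagier2001, §1.2 rule (3)] -/
theorem stub_torusExactness : ∀ (N : ℕ), 2 ≤ N → ∀ (q : ℚ) (a b m : ℕ), a ≠ b →
    ∀ (r : IntegralRep 2) (r₁ r₂ : IntegralRep 1),
    r.domain = cube 2 →
    EqOn r.integrand (fun p => (q : ℝ) * (p 0 ^ a * p 1 ^ b) / ((N : ℝ) - p 0 * p 1) ^ m) (cube 2) →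
    r₁.domain = cube 1 →
    EqOn r₁.integrand (fun p => ((q / ((a : ℚ) - b) : ℚ) : ℝ) * p 0 ^ b / ((N : ℝ) - p 0) ^ m) (cube 1) →
    r₂.domain = cube 1 →
    EqOn r₂.integrand (fun p => ((q / ((a : ℚ) - b) : ℚ) : ℝ) * p 0 ^ a / ((N : ℝ) - p 0) ^ m) (cube 1) →
    KZ.of r - (KZ.of r₁ - KZ.of r₂) ∈ KZ.relations := by
  intro N hN q a b m hab r r₁ r₂ hr hri hr₁ hr₁i hr₂ hr₂i
  exact torusExactness_assemble KZ.relations (torusExactness_bulk hN q m hab r hr hri)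
    (RFun.rel_sub _ _) (RFun.stokesAt 0 _) (RFun.stokesAt 1 _)
    (torusExactness_face_x_one hN _ a b m r₁ hr₁ hr₁i) (torusExactness_face_x_zero hN _ a b m)
    (torusExactness_face_y_one hN _ a b m r₂ hr₂ hr₂i) (torusExactness_face_y_zero hN _ a b m)

end Summit.KontsevichZagierPeriods.HermiteRigidity.ReductionRigidity
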